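/-
Copyright (c) 2026 the pub-hodgecm-mathlib formalisation cell (harness21).  Prover seat hodgecm-mathlib-LH5-p05 (g6); dealer LH4-plan (g7) WORDs #20∕#22, file C2-C of
the (C2)′ PH-tower re-key (census LH4-p01 (g6) `CENSUS-C2-PHTower.v1` 565a49c07283de56), 2026-09-02.  Bodies = ★ `UnitaryThreePHTowerPackage` (B-p04 (g33)) verbatim over C2-A ∕ C2-B.
-/
import Literature.NumberTheory.Automorphic.UnitaryThreePHTowerRhoUnramified     -- C2-A (LH4-p01 (g6)): `flickerPHRho_eq_iff_of_unram`, `index_flickerPH0_subgroupOf_flickerPH_of_unram`, `natCard_antifixed_eq_of_unram`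
import Literature.NumberTheory.Automorphic.UnitaryThreePHTowerIndexTrace       -- C2-B (LH4-p03 (g8)): `inf_flickerHK_le_flickerPH0_of_rel`, `index_inf_flickerHK_subgroupOf_flickerPH0_of_rel`
import Literature.NumberTheory.Automorphic.UnitaryThreePHTowerPackage          -- ★ FILE D (B-p04 (g33)): `natCard_units_quotient_eq` (CITE), ★ `flickerPH0_le`, defs `flickerPH ∕ flickerHK ∕ flickerPH0 ∕ flickerPHRho`
import HarnessLib

/-!
# The tower for Flicker's Prop. 8 (ii), FILE D re-keyed 2-FREE (C2-C): **`[P_H : P_H ∩ H^K_m] = (q² − 1)·q^{4m−2}`** (`= 1` at `m = 0`), finiteness of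
# `P_H ⧸ (P_H ∩ H^K_m)`, and the fibres of `ρ_m` on it have `q^m` elements — for the 2-free level elements `u_m^{(y,z)}`, every residue characteristic
(Flicker, *Elementary proof of the fundamental lemma for a unitary group* (1998), Prop. 8 pp. 84–85: `[P_H : P_H ∩ H^K_m] = (1 − q⁻²) q^{4m}`)

Topic `NumberTheory/Automorphic` (half A line LH4, LAYER C of the (D-UNR) type-(1) column, block (C2)′ = files C2-A ∕ C2-B ∕ C2-C of LH4-plan (g7) WORD #20);
namespace `Literature.NumberTheory.Automorphic.UnitaryGroup` (= ★'s).  THEOREMS ONLY (no `def`, no instance, no notation, no named fact, no `sorry`); kernel lane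
`--supports stmt-HodgeConjecture-24833`; NOT an edition of ★ `UnitaryThreePHTowerPackage` (untouched, imported for its CITE-class lemmas).

THE RE-KEY (census 565a49c0 §0–§1, rows «Package :122 ∕ :169 ∕ :185 ∕ :198 ∕ :223», class RE-FRAME): the symmetric-frame binders `(hd : LocalConjDatum σ ϖ) {y} (hy : y·σy = −2)
(hum : ↑um = !![ϖ^m, y, (ϖ^m)⁻¹; 0, 1, −σy·(ϖ^m)⁻¹; 0, 0, (ϖ^m)⁻¹])` become the 2-free block of ★ p851872 :107 —
`(hd : UnramifiedLocalConjDatum σ ϖ) (h2 : (2 : K) ≠ 0) {y z : K} (hy : Valued.v y = 1) (hzv : Valued.v z ≤ 1) (hz : z + σ z + y * σ y = 0) (hσO) (m) {u c}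
(hu : ↑u = !![ϖ ^ m, y, z * (ϖ ^ m)⁻¹; 0, 1, -σ y * (ϖ ^ m)⁻¹; 0, 0, (ϖ ^ m)⁻¹]) (hc : ↑c = diag(1,−1,1))` (+ `{q} (hq) {a₀} (ha₀)` for the counted heads; `finite_quotient_flickerHK_of_rel`
in (C4) §2's ∕ LH5-p03 (g7)'s binder order verbatim) — `h2` is a CHARACTERISTIC token (the Borel normal form ★ p851950 is called through C2-A ∕ C2-B), not `|2| = 1`.
Every right-hand side is ★'s VERBATIM: `#{anti-fixed} · (#(𝒪⧸𝓂^m)ˣ · #{anti-fixed})`, `(q ^ 2 − 1) * q ^ (4 * m − 2)`, `1`, `Finite (P_H ⧸ S)`, `∀ z ∈ range ρ, Nat.card {w ∕∕ ρ w = z} = q ^ m`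
(value changes: 0 — Prop. 8 (ii) persists at the unramified dyadic places, FINDING #6′).  Proofs = ★ FILE D's bodies with the five callees re-pointed:
★ `inf_flickerHK_le_flickerPH0` ↦ C2-B `…_of_rel`, ★ `index_inf_flickerHK_subgroupOf_flickerPH0` ↦ C2-B `…_of_rel`, ★ `index_flickerPH0_subgroupOf_flickerPH` ↦ C2-A `…_of_unram`,
★ `flickerPHRho_eq_iff` ↦ C2-A `…_of_unram`, ★ `natCard_antifixed_eq` ↦ C2-A `…_of_unram`; ★ `natCard_units_quotient_eq`, ★ `flickerPH0_le`, def `flickerPHRho` by CITE (unchanged, R4).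
These five heads are the hypotheses `hidx` ∕ `hidx0` ∕ `[Finite (P_H ⧸ S)]` ∕ `hfib` of the trace-frame Prop. 10 counts ((C5)′, instantiated at `(y, z) = (1, −b)` by the three one-liners
`(by rw [map_one]) (by rwa [Valuation.map_neg]) (by rw [map_neg, map_one]; linear_combination -hb)`) and (C4) C4-3.

HONEST LABEL: HC_CM is proved only modulo the 7 printed citations (2 remaining: hLiu418 = stmt-HodgeConjecture-24832, h413 = stmt-HodgeConjecture-24833) until rung 0 closes;
count-neutral structure theory ((D-UNR) PRINT by D74′; LAYER C pays the type-(1) row in house only when it closes).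

## References
* [Flicker1998UnitaryFL] Y. Z. Flicker, *Elementary proof of the fundamental lemma for a unitary group*, Canad. J. Math. 50 (1998), Prop. 8 pp. 84–85.
-/

set_option autoImplicit false

open scoped MatrixGroups WithZero Valued
open Matrix IsLocalRing

namespace Literature.NumberTheory.Automorphic

namespace UnitaryGroup

open Literature.NumberTheory.Automorphic.HermitianLattice (unitaryInt mem_unitaryInt_iff UnramifiedLocalConjDatum)

section PackageTrace

variable {K : Type*} [Field K] [Valued K ℤᵐ⁰] {ϖ : K} (σ : K →+* K) {J : Matrix (Fin 3) (Fin 3) K} (hJ : J = (StdForm.antidiagonal 3).over K)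

include hJ in
/-- **PROP. 8 (ii) as a product of class counts, 2-free** (twin of ★ `index_flickerHK_subgroupOf_flickerPH`, Package :122): for the 2-free level element `u = u_m^{(y,z)}`,
`[P_H : P_H ∩ H^K_m] = #{anti-fixed} · (#(𝒪⧸𝓂^m)ˣ · #{anti-fixed})` — the tower `P_H ⊇ N₀(ϖ^m) ⊇ P_H ∩ H^K_m` with C2-B's (H2) below and C2-A's (H1)+(H3) above
(`Subgroup.relIndex_mul_relIndex`). [cite: Flicker1998UnitaryFL, Prop. 8 pp. 84–85] -/
theorem index_flickerHK_subgroupOf_flickerPH_of_rel (hd : UnramifiedLocalConjDatum σ ϖ) (h2 : (2 : K) ≠ 0)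
    {y z : K} (hy : Valued.v y = 1) (hzv : Valued.v z ≤ 1) (hz : z + σ z + y * σ y = 0)
    (hσO : ∀ z : 𝒪[K], (σ.comp 𝒪[K].subtype) z ∈ 𝒪[K]) (m : ℕ) {u c : ↥(unitaryGroupOfForm σ J)}
    (hu : ((u : GL (Fin 3) K) : Matrix (Fin 3) (Fin 3) K) = !![ϖ ^ m, y, z * (ϖ ^ m)⁻¹; 0, 1, -σ y * (ϖ ^ m)⁻¹; 0, 0, (ϖ ^ m)⁻¹])
    (hc : ((c : GL (Fin 3) K) : Matrix (Fin 3) (Fin 3) K) = !![1, 0, 0; 0, -1, 0; 0, 0, 1]) :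
    ((flickerHK σ J c u).subgroupOf (flickerPH σ J c)).index =
      Nat.card {β : 𝒪[K] ⧸ 𝓂[K] ^ m //
          Ideal.quotientMap (𝓂[K] ^ m) ((σ.comp 𝒪[K].subtype).codRestrict 𝒪[K] hσO)
            (maximalIdeal_pow_le_comap_codRestrict σ hd.vϖ hd.vσ hσO m) β = -β} *
        (Nat.card (𝒪[K] ⧸ 𝓂[K] ^ m)ˣ *
          Nat.card {β : 𝒪[K] ⧸ 𝓂[K] ^ m //
            Ideal.quotientMap (𝓂[K] ^ m) ((σ.comp 𝒪[K].subtype).codRestrict 𝒪[K] hσO)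
              (maximalIdeal_pow_le_comap_codRestrict σ hd.vϖ hd.vσ hσO m) β = -β}) := by
  have hSN : flickerPH σ J c ⊓ flickerHK σ J c u ≤ flickerPH0 σ J c (ϖ ^ m) := inf_flickerHK_le_flickerPH0_of_rel σ hJ hd h2 hy hzv hz m hu hc
  have hNP : flickerPH0 σ J c (ϖ ^ m) ≤ flickerPH σ J c := flickerPH0_le c (ϖ ^ m)
  rw [← index_flickerPH0_subgroupOf_flickerPH_of_unram σ hJ hd h2 hσO m hc]
  rw [← index_inf_flickerHK_subgroupOf_flickerPH0_of_rel σ hJ hd h2 hy hzv hz hσO m hu hc]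
  change (flickerHK σ J c u).relIndex (flickerPH σ J c) =
    (flickerPH σ J c ⊓ flickerHK σ J c u).relIndex (flickerPH0 σ J c (ϖ ^ m)) * (flickerPH0 σ J c (ϖ ^ m)).relIndex (flickerPH σ J c)
  rw [Subgroup.relIndex_mul_relIndex _ _ _ hSN hNP, Subgroup.inf_relIndex_left]

variable [IsDiscreteValuationRing 𝒪[K]] [Finite (ResidueField 𝒪[K])]

include hJ in
/-- **FLICKER'S PROPOSITION 8 (ii), 2-free: `[P_H : P_H ∩ H^K_m] = (q² − 1)·q^{4m−2}`** for `m ≥ 1` and the 2-free level element `u_m^{(y,z)}` (print: `(1 − q⁻²) q^{4m}`;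
twin of ★ `index_flickerHK_subgroupOf_flickerPH_eq`, Package :169) — the hypothesis `hidx` of the trace-frame Prop. 10 count. [cite: Flicker1998UnitaryFL, Prop. 8 pp. 84–85] -/
theorem index_flickerHK_subgroupOf_flickerPH_eq_of_rel (hd : UnramifiedLocalConjDatum σ ϖ) (h2 : (2 : K) ≠ 0)
    {y z : K} (hy : Valued.v y = 1) (hzv : Valued.v z ≤ 1) (hz : z + σ z + y * σ y = 0)
    (hσO : ∀ z : 𝒪[K], (σ.comp 𝒪[K].subtype) z ∈ 𝒪[K]) {m : ℕ} (hm : 1 ≤ m) {u c : ↥(unitaryGroupOfForm σ J)}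
    (hu : ((u : GL (Fin 3) K) : Matrix (Fin 3) (Fin 3) K) = !![ϖ ^ m, y, z * (ϖ ^ m)⁻¹; 0, 1, -σ y * (ϖ ^ m)⁻¹; 0, 0, (ϖ ^ m)⁻¹])
    (hc : ((c : GL (Fin 3) K) : Matrix (Fin 3) (Fin 3) K) = !![1, 0, 0; 0, -1, 0; 0, 0, 1])
    {q : ℕ} (hq : Nat.card (ResidueField 𝒪[K]) = q ^ 2)
    {a₀ : 𝒪[K]} (ha₀ : IsUnit (((σ.comp 𝒪[K].subtype).codRestrict 𝒪[K] hσO) a₀ - a₀)) :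
    ((flickerHK σ J c u).subgroupOf (flickerPH σ J c)).index = (q ^ 2 - 1) * q ^ (4 * m - 2) := by
  rw [index_flickerHK_subgroupOf_flickerPH_of_rel σ hJ hd h2 hy hzv hz hσO m hu hc, natCard_antifixed_eq_of_unram σ hd hσO hq ha₀ m,
    natCard_units_quotient_eq hq m, if_neg (by omega)]
  obtain ⟨k, rfl⟩ := Nat.exists_eq_add_of_le' hm
  rw [Nat.add_sub_cancel, show 4 * (k + 1) - 2 = k + 1 + 2 * k + (k + 1) by omega]
  ring

include hJ in
/-- **PROP. 8 (ii) at `m = 0`, 2-free: `[P_H : P_H ∩ H^K_0] = 1`** (everything is integral; twin of ★ `index_flickerHK_subgroupOf_flickerPH_eq_one`, Package :185) — the hypothesis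
`hidx0` of the trace-frame Prop. 10 count. [cite: Flicker1998UnitaryFL, Prop. 8 pp. 84–85] -/
theorem index_flickerHK_subgroupOf_flickerPH_eq_one_of_rel (hd : UnramifiedLocalConjDatum σ ϖ) (h2 : (2 : K) ≠ 0)
    {y z : K} (hy : Valued.v y = 1) (hzv : Valued.v z ≤ 1) (hz : z + σ z + y * σ y = 0)
    (hσO : ∀ z : 𝒪[K], (σ.comp 𝒪[K].subtype) z ∈ 𝒪[K]) {u c : ↥(unitaryGroupOfForm σ J)}
    (hu : ((u : GL (Fin 3) K) : Matrix (Fin 3) (Fin 3) K) = !![ϖ ^ 0, y, z * (ϖ ^ 0)⁻¹; 0, 1, -σ y * (ϖ ^ 0)⁻¹; 0, 0, (ϖ ^ 0)⁻¹])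
    (hc : ((c : GL (Fin 3) K) : Matrix (Fin 3) (Fin 3) K) = !![1, 0, 0; 0, -1, 0; 0, 0, 1])
    {q : ℕ} (hq : Nat.card (ResidueField 𝒪[K]) = q ^ 2)
    {a₀ : 𝒪[K]} (ha₀ : IsUnit (((σ.comp 𝒪[K].subtype).codRestrict 𝒪[K] hσO) a₀ - a₀)) :
    ((flickerHK σ J c u).subgroupOf (flickerPH σ J c)).index = 1 := by
  rw [index_flickerHK_subgroupOf_flickerPH_of_rel σ hJ hd h2 hy hzv hz hσO 0 hu hc, natCard_antifixed_eq_of_unram σ hd hσO hq ha₀ 0,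
    natCard_units_quotient_eq hq 0, if_pos rfl, pow_zero, mul_one, mul_one]

include hJ in
/-- `P_H ⧸ (P_H ∩ H^K_m)` is FINITE for the 2-free level element `u_m^{(y,z)}` (its cardinality is `(q²−1)q^{4m−2}` resp. `1`; twin of ★ `finite_quotient_flickerHK`, Package :198;
name and binder order = (C4) §2's assumed head, LH5-p03 (g7)) — the instance binder of the trace-frame Prop. 10 count. [cite: Flicker1998UnitaryFL, Prop. 8 pp. 84–85] -/
theorem finite_quotient_flickerHK_of_rel (hd : UnramifiedLocalConjDatum σ ϖ) (h2 : (2 : K) ≠ 0)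
    {y z : K} (hy : Valued.v y = 1) (hzv : Valued.v z ≤ 1) (hz : z + σ z + y * σ y = 0)
    (hσO : ∀ z : 𝒪[K], (σ.comp 𝒪[K].subtype) z ∈ 𝒪[K]) (m : ℕ) {u c : ↥(unitaryGroupOfForm σ J)}
    (hu : ((u : GL (Fin 3) K) : Matrix (Fin 3) (Fin 3) K) = !![ϖ ^ m, y, z * (ϖ ^ m)⁻¹; 0, 1, -σ y * (ϖ ^ m)⁻¹; 0, 0, (ϖ ^ m)⁻¹])
    (hc : ((c : GL (Fin 3) K) : Matrix (Fin 3) (Fin 3) K) = !![1, 0, 0; 0, -1, 0; 0, 0, 1])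
    {q : ℕ} (hq : Nat.card (ResidueField 𝒪[K]) = q ^ 2)
    {a₀ : 𝒪[K]} (ha₀ : IsUnit (((σ.comp 𝒪[K].subtype).codRestrict 𝒪[K] hσO) a₀ - a₀)) :
    Finite (↥(flickerPH σ J c) ⧸ (flickerHK σ J c u).subgroupOf (flickerPH σ J c)) := by
  have hq2 : 2 ≤ q := by
    have h1 : 1 < Nat.card (ResidueField 𝒪[K]) := Finite.one_lt_card_iff_nontrivial.2 inferInstance
    rw [hq] at h1
    by_contra hlt
    interval_cases q <;> simp at h1
  haveI : ((flickerHK σ J c u).subgroupOf (flickerPH σ J c)).FiniteIndex := by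
    refine ⟨?_⟩
    rw [index_flickerHK_subgroupOf_flickerPH_of_rel σ hJ hd h2 hy hzv hz hσO m hu hc, natCard_antifixed_eq_of_unram σ hd hσO hq ha₀ m,
      natCard_units_quotient_eq hq m]
    split_ifs with hm
    · positivity
    · have : 1 ≤ q ^ 2 - 1 := Nat.le_sub_of_add_le (by nlinarith)
      positivity
  infer_instance

omit [Finite (ResidueField 𝒪[K])] in
include hJ in
/-- **THE FIBRES OF `ρ_m` ON `P_H ⧸ (P_H ∩ H^K_m)` HAVE `q^m` ELEMENTS, 2-free** (twin of ★ `natCard_fibre_flickerPHRho_eq`, Package :223; `ρ_m = flickerPHRho σ m` UNCHANGED, R4):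
for the 2-free level element `u_m^{(y,z)}` the cosets `w` with `ρ_m(out w) = ρ_m(p₀)` are exactly those inside `p₀·N₀(ϖ^m)` (C2-A's (H1)), in bijection with `N₀ ⧸ (P_H ∩ H^K_m)`
(C2-B's (H2): `#{anti-fixed} = q^m`) — the hypothesis `hfib` of the trace-frame Prop. 10 count. [cite: Flicker1998UnitaryFL, Prop. 8 pp. 84–85] -/
theorem natCard_fibre_flickerPHRho_eq_of_rel (hd : UnramifiedLocalConjDatum σ ϖ) (h2 : (2 : K) ≠ 0)
    {y z : K} (hy : Valued.v y = 1) (hzv : Valued.v z ≤ 1) (hz : z + σ z + y * σ y = 0)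
    (hσO : ∀ z : 𝒪[K], (σ.comp 𝒪[K].subtype) z ∈ 𝒪[K]) (m : ℕ) {u c : ↥(unitaryGroupOfForm σ J)}
    (hu : ((u : GL (Fin 3) K) : Matrix (Fin 3) (Fin 3) K) = !![ϖ ^ m, y, z * (ϖ ^ m)⁻¹; 0, 1, -σ y * (ϖ ^ m)⁻¹; 0, 0, (ϖ ^ m)⁻¹])
    (hc : ((c : GL (Fin 3) K) : Matrix (Fin 3) (Fin 3) K) = !![1, 0, 0; 0, -1, 0; 0, 0, 1])
    {q : ℕ} (hq : Nat.card (ResidueField 𝒪[K]) = q ^ 2)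
    {a₀ : 𝒪[K]} (ha₀ : IsUnit (((σ.comp 𝒪[K].subtype).codRestrict 𝒪[K] hσO) a₀ - a₀)) :
    ∀ z ∈ Set.range (fun w : ↥(flickerPH σ J c) ⧸ (flickerHK σ J c u).subgroupOf (flickerPH σ J c) =>
        flickerPHRho σ m ((Quotient.out w : ↥(flickerPH σ J c)) : ↥(unitaryGroupOfForm σ J))),
      Nat.card {w : ↥(flickerPH σ J c) ⧸ (flickerHK σ J c u).subgroupOf (flickerPH σ J c) //
        flickerPHRho σ m ((Quotient.out w : ↥(flickerPH σ J c)) : ↥(unitaryGroupOfForm σ J)) = z} = q ^ m := by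
  rintro z₀ ⟨w₀, rfl⟩
  show Nat.card {w : ↥(flickerPH σ J c) ⧸ ((flickerHK σ J c u).subgroupOf (flickerPH σ J c)) // flickerPHRho σ m ((Quotient.out w : ↥(flickerPH σ J c)) : ↥(unitaryGroupOfForm σ J)) = flickerPHRho σ m ((Quotient.out w₀ : ↥(flickerPH σ J c)) : ↥(unitaryGroupOfForm σ J))} = q ^ m
  have hSN : flickerPH σ J c ⊓ flickerHK σ J c u ≤ flickerPH0 σ J c (ϖ ^ m) := inf_flickerHK_le_flickerPH0_of_rel σ hJ hd h2 hy hzv hz m hu hc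
  have hNP : flickerPH0 σ J c (ϖ ^ m) ≤ flickerPH σ J c := flickerPH0_le c (ϖ ^ m)
  have hS'N' : ((flickerHK σ J c u).subgroupOf (flickerPH σ J c)) ≤ ((flickerPH0 σ J c (ϖ ^ m)).subgroupOf (flickerPH σ J c)) := by
    intro s hs
    rw [Subgroup.mem_subgroupOf] at hs ⊢
    exact hSN ⟨s.2, hs⟩
  -- (H1) on `P_H`: `ρ p = ρ p' ↔ p⁻¹ p' ∈ N'`
  have hH1 : ∀ p p' : ↥(flickerPH σ J c), flickerPHRho σ m (p : ↥(unitaryGroupOfForm σ J)) = flickerPHRho σ m (p' : ↥(unitaryGroupOfForm σ J)) ↔ p⁻¹ * p' ∈ ((flickerPH0 σ J c (ϖ ^ m)).subgroupOf (flickerPH σ J c)) := by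
    intro p p'
    rw [Subgroup.mem_subgroupOf, Subgroup.coe_mul, Subgroup.coe_inv]
    exact flickerPHRho_eq_iff_of_unram σ hJ hd h2 hc m p.2 p'.2
  -- the fibre is in bijection with `N' ⧸ S'.subgroupOf N'`
  let F := {w : ↥(flickerPH σ J c) ⧸ ((flickerHK σ J c u).subgroupOf (flickerPH σ J c)) // flickerPHRho σ m ((Quotient.out w : ↥(flickerPH σ J c)) : ↥(unitaryGroupOfForm σ J)) = flickerPHRho σ m ((Quotient.out w₀ : ↥(flickerPH σ J c)) : ↥(unitaryGroupOfForm σ J))}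
  have hmemF : ∀ n : ↥((flickerPH0 σ J c (ϖ ^ m)).subgroupOf (flickerPH σ J c)), flickerPHRho σ m ((Quotient.out (QuotientGroup.mk ((Quotient.out w₀ : ↥(flickerPH σ J c)) * (n : ↥(flickerPH σ J c))) : ↥(flickerPH σ J c) ⧸ ((flickerHK σ J c u).subgroupOf (flickerPH σ J c))) : ↥(flickerPH σ J c)) : ↥(unitaryGroupOfForm σ J)) =
      flickerPHRho σ m ((Quotient.out w₀ : ↥(flickerPH σ J c)) : ↥(unitaryGroupOfForm σ J)) := by
    intro n
    obtain ⟨s, hs⟩ := QuotientGroup.mk_out_eq_mul ((flickerHK σ J c u).subgroupOf (flickerPH σ J c)) ((Quotient.out w₀ : ↥(flickerPH σ J c)) * (n : ↥(flickerPH σ J c)))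
    rw [hs, eq_comm, hH1, ← mul_assoc, ← mul_assoc, inv_mul_cancel, one_mul]
    exact Subgroup.mul_mem _ n.2 (hS'N' s.2)
  let ψ : ↥((flickerPH0 σ J c (ϖ ^ m)).subgroupOf (flickerPH σ J c)) → F := fun n => ⟨QuotientGroup.mk ((Quotient.out w₀ : ↥(flickerPH σ J c)) * (n : ↥(flickerPH σ J c))), hmemF n⟩
  have hψ : ∀ a b : ↥((flickerPH0 σ J c (ϖ ^ m)).subgroupOf (flickerPH σ J c)), QuotientGroup.leftRel (((flickerHK σ J c u).subgroupOf (flickerPH σ J c)).subgroupOf ((flickerPH0 σ J c (ϖ ^ m)).subgroupOf (flickerPH σ J c))) a b → ψ a = ψ b := by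
    intro a b hab
    rw [QuotientGroup.leftRel_apply, Subgroup.mem_subgroupOf, Subgroup.coe_mul, Subgroup.coe_inv] at hab
    apply Subtype.ext
    change (QuotientGroup.mk ((Quotient.out w₀ : ↥(flickerPH σ J c)) * (a : ↥(flickerPH σ J c))) : ↥(flickerPH σ J c) ⧸ ((flickerHK σ J c u).subgroupOf (flickerPH σ J c))) = QuotientGroup.mk ((Quotient.out w₀ : ↥(flickerPH σ J c)) * (b : ↥(flickerPH σ J c)))
    rw [QuotientGroup.eq, _root_.mul_inv_rev, mul_assoc, inv_mul_cancel_left]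
    exact hab
  have hbij : Function.Bijective (Quotient.lift ψ hψ : ↥((flickerPH0 σ J c (ϖ ^ m)).subgroupOf (flickerPH σ J c)) ⧸ ((flickerHK σ J c u).subgroupOf (flickerPH σ J c)).subgroupOf ((flickerPH0 σ J c (ϖ ^ m)).subgroupOf (flickerPH σ J c)) → F) := by
    constructor
    · intro q₁ q₂ h
      induction q₁ using QuotientGroup.induction_on with | H a => ?_
      induction q₂ using QuotientGroup.induction_on with | H b => ?_
      apply Quotient.sound
      change QuotientGroup.leftRel (((flickerHK σ J c u).subgroupOf (flickerPH σ J c)).subgroupOf ((flickerPH0 σ J c (ϖ ^ m)).subgroupOf (flickerPH σ J c))) a b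
      rw [QuotientGroup.leftRel_apply, Subgroup.mem_subgroupOf, Subgroup.coe_mul, Subgroup.coe_inv]
      have h' : (QuotientGroup.mk ((Quotient.out w₀ : ↥(flickerPH σ J c)) * (a : ↥(flickerPH σ J c))) : ↥(flickerPH σ J c) ⧸ ((flickerHK σ J c u).subgroupOf (flickerPH σ J c))) = QuotientGroup.mk ((Quotient.out w₀ : ↥(flickerPH σ J c)) * (b : ↥(flickerPH σ J c))) :=
        congrArg Subtype.val h
      rw [QuotientGroup.eq, _root_.mul_inv_rev, mul_assoc, inv_mul_cancel_left] at h'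
      exact h'
    · rintro ⟨w, hw⟩
      have hn : (Quotient.out w₀ : ↥(flickerPH σ J c))⁻¹ * Quotient.out w ∈ ((flickerPH0 σ J c (ϖ ^ m)).subgroupOf (flickerPH σ J c)) := (hH1 _ _).1 hw.symm
      refine ⟨QuotientGroup.mk ⟨_, hn⟩, Subtype.ext ?_⟩
      change (QuotientGroup.mk ((Quotient.out w₀ : ↥(flickerPH σ J c)) * ((Quotient.out w₀ : ↥(flickerPH σ J c))⁻¹ * Quotient.out w)) : ↥(flickerPH σ J c) ⧸ ((flickerHK σ J c u).subgroupOf (flickerPH σ J c))) = w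
      rw [mul_inv_cancel_left, QuotientGroup.out_eq']
  refine (Nat.card_congr (Equiv.ofBijective _ hbij)).symm.trans ?_
  change (((flickerHK σ J c u).subgroupOf (flickerPH σ J c)).subgroupOf ((flickerPH0 σ J c (ϖ ^ m)).subgroupOf (flickerPH σ J c))).index = q ^ m
  rw [← natCard_antifixed_eq_of_unram σ hd hσO hq ha₀ m, ← index_inf_flickerHK_subgroupOf_flickerPH0_of_rel σ hJ hd h2 hy hzv hz hσO m hu hc]
  -- `[N' : S'] = [N₀ : P_H ∩ H^K_m]`
  change ((flickerHK σ J c u).subgroupOf (flickerPH σ J c)).relIndex ((flickerPH0 σ J c (ϖ ^ m)).subgroupOf (flickerPH σ J c)) = (flickerPH σ J c ⊓ flickerHK σ J c u).relIndex (flickerPH0 σ J c (ϖ ^ m))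
  rw [Subgroup.relIndex_subgroupOf (H := flickerHK σ J c u) hNP,
    ← Subgroup.inf_relIndex_right (flickerHK σ J c u) (flickerPH0 σ J c (ϖ ^ m)),
    ← Subgroup.inf_relIndex_right (flickerPH σ J c ⊓ flickerHK σ J c u) (flickerPH0 σ J c (ϖ ^ m))]
  congr 1
  apply le_antisymm
  · exact le_inf (le_inf (inf_le_right.trans hNP) inf_le_left) inf_le_right
  · exact le_inf (inf_le_left.trans inf_le_right) inf_le_right

end PackageTrace

end UnitaryGroup

end Literature.NumberTheory.Automorphic
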